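import Mathlib
import Literature.Analysis.Complex.ConeTubeIdentity

/-!
# `Balaban1983to89.B11Eq181AnalyticExtension` — T. Bałaban, *The variational problem and background fields in renormalization group method
# for lattice gauge theories*, Commun. Math. Phys. **102** (1985) 277–309 [Balaban1985Variational], p. 307: the step
# *«This equality [(181)] extends by analyticity to Gᶜ-valued configurations V …, and then, again by analyticity, to Gᶜ-valued gauge
# transformations v»* — its MECHANISM proved: the identity principle for the real slice ℝⁿ ⊂ ℂⁿ (two analytic functions on a connected
# open set containing a real point which agree at the real points agree everywhere)

statement-level skeleton of published theorems with citation tags; proofs where landed; nothing here is a claim about the Yang–Mills mass gap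

PDF held: `paper:balaban1985-cmp102-variational-background` (journal page = PDF page + 276); p. 307 [PDF 31] read by this seat from the
`lit read` text layer (2026-08-21).

CITATION HEADER (lean-in-tree rule 2026-08-18).  WHAT IS REPRODUCED: SKELETON row **B11.Eq181** (reader r08 `ROWS-B11.md`; head
`proved p239569` for the G-valued equivariance `B11Eq181Covariance.minimiser_smul` + `typed-existing (carrier ExtOrbits; analytic
continuation part)`), the analytic-continuation sentences of p. 307 [PDF 31], verbatim: *«It is an analytic function of V, for V with
values in a small neighborhood of the identity in Gᶜ, and for V with values in G it coincides with the minimal configuration constructed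
in the previous sections. This function can be extended further using gauge transformations. For the minimal configurations in the axial
gauge we have U_k(V^v) = U_k(V)^v̄, (181) where v̄ is constant on blocks Bʲ(y), y ∈ Λ_j, and equal to v(y). This equality extends by
analyticity to Gᶜ-valued configurations V described above, and then, again by analyticity, to Gᶜ-valued gauge transformations v in a
small neighborhood of G-valued transformations. This means that we can prove the equality (181) for all these v for which V^v is in the
analyticity domain of U_k.»*  The step «extends by analyticity» is the classical IDENTITY PRINCIPLE FOR A MAXIMAL TOTALLY REAL SLICE: on the
finite lattice a configuration V near the identity is coordinatised by B = (1/i) log V ∈ (𝔤ᶜ)^{bonds} ≅ ℂⁿ, the G-valued ones being the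
REAL points, and two analytic functions of B agreeing at real points agree on the connected analyticity domain.  Mathlib has the identity
theorem for functions agreeing near a point (`AnalyticOnNhd.eqOn_of_preconnected_of_eventuallyEq`); the tree has the ONE-VARIABLE
real-points version `Literature.Analysis.Complex.eqOn_of_isPreconnected_of_eq_ofReal` (`ConeTubeIdentity`, reused BY NAME in §1) and the
ENTIRE-function real-span version `Literature.Analysis.Complex.vanish_on_complexSpan_of_vanish_on_realSpan` (`RealSpanVanishing`); the
LOCAL several-variable version (open preconnected `U ⊆ ℂⁿ`) needed here is supplied.

WHAT IS CERTIFIED (kernel, sorry-free; axioms standard).  `F` a complex Banach space.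
* §1 `eqOn_zero_ball_of_real_zero` — ONE VARIABLE: `φ : ℂ → F` analytic on `ball c r`, `c.im = 0`, `φ w = 0` for all real `w` in the disc
  ⟹ `φ = 0` on the disc (the tree's `eqOn_of_isPreconnected_of_eq_ofReal` on the convex disc).
* §2 `eqOn_zero_ball_of_realPoints_zero` — SEVERAL VARIABLES (`Fin n → ℂ`, sup norm, so balls are polydiscs): `h` analytic on
  `ball c r` with `c` real (`(c i).im = 0`), `h z = 0` at all real points `z` of the ball ⟹ `h = 0` on the ball; induction on the number
  of coordinates allowed to be complex, each step a §1 disc in one coordinate (`ins_apply`, `analyticAt_ins`: replacing the k-th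
  coordinate is affine/analytic and keeps the polydisc).
* §3 **`eqOn_of_eqOn_realPoints`** — `f`, `g` analytic on an open preconnected `U ∋ c` (`c` real) with `f = g` at the real points of `U`
  ⟹ `EqOn f g U`; `eqOn_of_eqOn_ofReal` (real points as `ofReal`-vectors `Fin n → ℝ`).
* §4 **`eq181_extends_by_analyticity`** — the printed step: the two sides `lhs`, `rhs` of (181), analytic on the connected analyticity
  domain `U` (containing a real point) and equal at its real points (the G-valued case, `B11Eq181Covariance.minimiser_smul`), are equal
  on `U`; the second extension («again by analyticity», in the coordinates of v) is the same theorem in the v-variables.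

MODELLING / HONEST SCOPE.  (M1) Coordinates: the finite lattice makes the configuration space finite-dimensional; `Fin n → ℂ` with the sup
norm is the coordinate model of (𝔤ᶜ)^{bonds} near the identity (n = #bonds · dim 𝔤), real coordinates = 𝔤-valued logarithms = G-valued
V (the chart V = exp(iB) itself, [6] (1.31), is not constructed here).  (M2) The objects U_k, V^v, U_k(V)^v̄ and their analyticity
domains are NOT constructed: `lhs`/`rhs`/`U` are data, the analyticity letters are hypotheses exactly as print asserts them («It is an
analytic function of V»); what is proved is the inference «equal for G-valued ⟹ equal on the complex domain».  (M3) The further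
extension «to all Gᶜ-valued v treating the equality as a definition» (p. 307) is definitional and not typed.  No definition, no new
named fact.  Mega-formalization `lit-balaban`, HOME `run/shared/lean/pub/lit-balaban/`, reader/typer seat r08 gen 9 (unit
`lit-balaban-r08`, B11 fold owner).  Imports Mathlib and `Literature.Analysis.Complex.ConeTubeIdentity`; modifies nothing there.
-/

namespace Literature.MathematicalPhysics.QuantumFieldTheory.Balaban1983to89.B11Eq181AnalyticExtension

open Metric Set Filter Topology

variable {F : Type*} [NormedAddCommGroup F] [NormedSpace ℂ F] [CompleteSpace F]

/-! ## §1 One complex variable: an analytic function on a disc centred at a real point, vanishing at the real points of the disc, vanishes -/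

/-- **Real-slice identity principle, one variable** — the tree's `Literature.Analysis.Complex.eqOn_of_isPreconnected_of_eq_ofReal`
(identity theorem from the real points of a preconnected open set) on a disc: `φ` analytic on `ball c r` with `c` real (`c.im = 0`) and
`φ w = 0` for every REAL `w` in the disc ⟹ `φ = 0` on the disc. [cite: Balaban1985Variational, p.307] -/
theorem eqOn_zero_ball_of_real_zero {φ : ℂ → F} {c : ℂ} {r : ℝ} (hc : c.im = 0) (hφ : AnalyticOnNhd ℂ φ (ball c r))
    (h0 : ∀ w ∈ ball c r, w.im = 0 → φ w = 0) : EqOn φ 0 (ball c r) := by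
  rcases le_or_gt r 0 with hr | hr
  · intro z hz
    exact absurd (mem_ball.mp hz) (not_lt.mpr (hr.trans dist_nonneg))
  have hcre : ((c.re : ℝ) : ℂ) = c := Complex.ext (by simp) (by simp [hc])
  have hcmem : ((c.re : ℝ) : ℂ) ∈ ball c r := by rw [hcre]; exact mem_ball_self hr
  exact Literature.Analysis.Complex.eqOn_of_isPreconnected_of_eq_ofReal isOpen_ball (convex_ball c r).isPreconnected hcmem
    hφ.differentiableOn (differentiableOn_const (0 : F)) fun t ht => h0 _ ht (Complex.ofReal_im t)

/-! ## §2 Several variables (`Fin n → ℂ`, sup norm): vanishing at the real points of a polydisc centred at a real point ⟹ vanishing -/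

section Several

variable {n : ℕ}

/-- Replacing the `k`-th coordinate of `z` by `w` (an affine, hence analytic, map of `w`). [cite: Balaban1985Variational, p.307] -/
theorem ins_apply (z : Fin n → ℂ) (k : Fin n) (w : ℂ) (i : Fin n) :
    (z + (w - z k) • (Pi.single k (1 : ℂ) : Fin n → ℂ)) i = if i = k then w else z i := by
  by_cases hi : i = k
  · subst hi; simp
  · simp [hi]

/-- The coordinate-replacement map is analytic in the new coordinate. [cite: Balaban1985Variational, p.307] -/
theorem analyticAt_ins (z : Fin n → ℂ) (k : Fin n) (w₀ : ℂ) :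
    AnalyticAt ℂ (fun w : ℂ => z + (w - z k) • (Pi.single k (1 : ℂ) : Fin n → ℂ)) w₀ :=
  analyticAt_const.add ((analyticAt_id.sub analyticAt_const).smul analyticAt_const)

/-- **Real-slice identity principle on a polydisc.**  `h` analytic on the ball `ball c r` of `Fin n → ℂ` (sup norm: a polydisc) centred at a
REAL point `c` (`(c i).im = 0`), vanishing at every real point of the ball ⟹ `h = 0` on the ball.  Induction on the number of coordinates
allowed to be complex, one variable (§1) at a time. [cite: Balaban1985Variational, p.307] -/
theorem eqOn_zero_ball_of_realPoints_zero {h : (Fin n → ℂ) → F} {c : Fin n → ℂ} {r : ℝ} (hc : ∀ i, (c i).im = 0)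
    (hh : AnalyticOnNhd ℂ h (ball c r)) (h0 : ∀ z ∈ ball c r, (∀ i, (z i).im = 0) → h z = 0) :
    EqOn h 0 (ball c r) := by
  rcases le_or_gt r 0 with hr | hr
  · intro z hz
    exact absurd (mem_ball.mp hz) (not_lt.mpr (hr.trans dist_nonneg))
  -- P k : the statement for points whose coordinates of index ≥ k are real
  have key : ∀ k : ℕ, ∀ z ∈ ball c r, (∀ i : Fin n, k ≤ i.val → (z i).im = 0) → h z = 0 := by
    intro k
    induction k with
    | zero => exact fun z hz hreal => h0 z hz fun i => hreal i (Nat.zero_le _)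
    | succ k ih =>
      intro z hz hreal
      by_cases hk : k < n
      · set kk : Fin n := ⟨k, hk⟩ with hkk
        set ins : ℂ → (Fin n → ℂ) := fun w => z + (w - z kk) • (Pi.single kk (1 : ℂ) : Fin n → ℂ) with hins
        have hins_apply : ∀ w i, ins w i = if i = kk then w else z i := fun w i => ins_apply z kk w i
        have hzc : ∀ i, dist (z i) (c i) < r := (dist_pi_lt_iff hr).mp (mem_ball.mp hz)
        -- the modified point stays in the polydisc when the new coordinate is in the disc
        have hmem : ∀ w ∈ ball (c kk) r, ins w ∈ ball c r := by
          intro w hw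
          rw [mem_ball, dist_pi_lt_iff hr]
          intro i
          rw [hins_apply]
          split_ifs with hi
          · subst hi; exact mem_ball.mp hw
          · exact hzc i
        -- the section is analytic on the disc and vanishes at its real points (induction hypothesis)
        have hφ : AnalyticOnNhd ℂ (fun w => h (ins w)) (ball (c kk) r) := fun w hw =>
          (hh _ (hmem w hw)).comp_of_eq (analyticAt_ins z kk w) rfl
        have hφ0 : ∀ w ∈ ball (c kk) r, w.im = 0 → h (ins w) = 0 := by
          intro w hw hwim
          refine ih (ins w) (hmem w hw) fun i hi => ?_
          rw [hins_apply]
          split_ifs with hik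
          · exact hwim
          · refine hreal i ?_
            have hne : i.val ≠ k := fun hik' => hik (Fin.ext (by rw [hik']))
            omega
        have hzero := eqOn_zero_ball_of_real_zero (hc kk) hφ hφ0 (mem_ball.mpr (hzc kk))
        -- at `w = z kk` the modified point is `z` itself
        have hself : ins (z kk) = z := by
          funext i; rw [hins_apply]; split_ifs with hi
          · rw [hi]
          · rfl
        simpa [hself] using hzero
      · -- no coordinate of index ≥ k + 1... but also none of index k: all coordinates real already
        refine ih z hz fun i hi => hreal i ?_
        have := i.isLt
        omega
  intro z hz
  exact key n z hz fun i hi => absurd i.isLt (not_lt.mpr hi)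

/-! ## §3 The identity principle on a preconnected open set containing a real point -/

/-- **Two analytic functions on a preconnected open `U ⊆ ℂⁿ` that agree at the REAL points of `U`, `U` containing a real point, agree on `U`**
(the classical identity principle for the maximal totally real slice ℝⁿ ⊂ ℂⁿ; §2 near the real point, then Mathlib's identity theorem
`AnalyticOnNhd.eqOn_of_preconnected_of_eventuallyEq`). [cite: Balaban1985Variational, p.307] -/
theorem eqOn_of_eqOn_realPoints {f g : (Fin n → ℂ) → F} {U : Set (Fin n → ℂ)} (hU : IsOpen U) (hUc : IsPreconnected U)
    (hf : AnalyticOnNhd ℂ f U) (hg : AnalyticOnNhd ℂ g U) {c : Fin n → ℂ} (hc : ∀ i, (c i).im = 0) (hcU : c ∈ U)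
    (hfg : ∀ z ∈ U, (∀ i, (z i).im = 0) → f z = g z) : EqOn f g U := by
  obtain ⟨r, hr, hball⟩ := Metric.isOpen_iff.mp hU c hcU
  have hsub : AnalyticOnNhd ℂ (f - g) (ball c r) := (hf.sub hg).mono hball
  have hzero : EqOn (f - g) 0 (ball c r) :=
    eqOn_zero_ball_of_realPoints_zero hc hsub fun z hz hreal => by
      rw [Pi.sub_apply, sub_eq_zero]; exact hfg z (hball hz) hreal
  refine hf.eqOn_of_preconnected_of_eventuallyEq hg hUc hcU ?_
  filter_upwards [ball_mem_nhds c hr] with z hz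
  exact sub_eq_zero.mp (hzero hz)

/-- The same with real points written as `ofReal`-vectors `x : Fin n → ℝ`. [cite: Balaban1985Variational, p.307] -/
theorem eqOn_of_eqOn_ofReal {f g : (Fin n → ℂ) → F} {U : Set (Fin n → ℂ)} (hU : IsOpen U) (hUc : IsPreconnected U)
    (hf : AnalyticOnNhd ℂ f U) (hg : AnalyticOnNhd ℂ g U) {x₀ : Fin n → ℝ} (hx₀ : (fun i => (x₀ i : ℂ)) ∈ U)
    (hfg : ∀ x : Fin n → ℝ, (fun i => (x i : ℂ)) ∈ U → f (fun i => (x i : ℂ)) = g (fun i => (x i : ℂ))) :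
    EqOn f g U := by
  refine eqOn_of_eqOn_realPoints hU hUc hf hg (c := fun i => (x₀ i : ℂ)) (fun i => Complex.ofReal_im _) hx₀ ?_
  intro z hz hreal
  have hz' : z = fun i => ((z i).re : ℂ) := by
    funext i
    exact Complex.ext (by simp) (by simp [hreal i])
  rw [hz'] at hz ⊢
  exact hfg _ hz

/-! ## §4 (181) «extends by analyticity» -/

/-- **(181) extends by analyticity** (p. 307 [31], verbatim: *«For the minimal configurations in the axial gauge we have U_k(V^v) = U_k(V)^v̄, (181)
where v̄ is constant on blocks Bʲ(y), y ∈ Λ_j, and equal to v(y). This equality extends by analyticity to Gᶜ-valued configurations V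
described above, and then, again by analyticity, to Gᶜ-valued gauge transformations v in a small neighborhood of G-valued transformations.
This means that we can prove the equality (181) for all these v for which V^v is in the analyticity domain of U_k.»*) — the MECHANISM,
proved: in coordinates `B = (1/i) log V ∈ (𝔤ᶜ)^{bonds} ≅ ℂⁿ` (finite lattice; REAL coordinates = G-valued configurations, resp.
transformations) the two sides of (181) are analytic `F`-valued functions `lhs`, `rhs` on the (open, connected) analyticity domain `U`, which
contains a real point; they agree at the real points (the G-valued case — row B11.Eq181's `B11Eq181Covariance.minimiser_smul`, the
equivariance of the unique constrained minimiser); HENCE they agree on all of `U`.  The second extension («again by analyticity», in the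
coordinates of `v`) is the same statement applied in the `v`-variables. [cite: Balaban1985Variational, (181) p.307, Prop. 9 p.309] -/
theorem eq181_extends_by_analyticity {lhs rhs : (Fin n → ℂ) → F} {U : Set (Fin n → ℂ)} (hU : IsOpen U)
    (hUc : IsPreconnected U) (hlhs : AnalyticOnNhd ℂ lhs U) (hrhs : AnalyticOnNhd ℂ rhs U) {c : Fin n → ℂ}
    (hc : ∀ i, (c i).im = 0) (hcU : c ∈ U) (h181_real : ∀ z ∈ U, (∀ i, (z i).im = 0) → lhs z = rhs z) :
    EqOn lhs rhs U :=
  eqOn_of_eqOn_realPoints hU hUc hlhs hrhs hc hcU h181_real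

end Several

end Literature.MathematicalPhysics.QuantumFieldTheory.Balaban1983to89.B11Eq181AnalyticExtension
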